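import Summits.QuantumFields.YangMills.Theorems.BalabanUVNodesN15SiteScalarLayerDressed
import Summits.QuantumFields.YangMills.Theorems.BalabanUVNodesN15FullPropagatorC2BgExactUnitN15At
import HarnessLib

/-!
# Route «BalabanUVNodes», cluster K4 «SpineRates» — node N15 = NE2: THE SITE LAYER WITH THE BACKGROUND LIVE IN THE TwoGrid ENTRY CURRENCY, X — THE FIRST FAMILY WITH ALL THREE
# LAYERS READING THE BACKGROUND: dag-n15-c's primitive-carrier family (`fgInstanceC2`, genuine Landau-gauge `G = Δ_a⁻¹`), OPERATOR = FILE 11, UNIT = dag-n15-a V-D's exact dressing,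
# SITE = the genuine massless scalar site propagator `G′ = (−Δ^η + a_kQ′*Q′)⁻¹` dressed (dag-n15-c S4) by the scalar-site species READ OFF the family's coefficient configuration —
# `N15At` on the sub-index `m ≥ 1`

Cell `pub-ymgap`, WIDTH SEAT `pub-ymgap-dag-n15-w1` (generation 2; director-ym №197 ∕ HUMAN RULING D-0149; chair R455 (A) ∕ R461; plan g81 `W-SEAT-START-LIST.md` v8 §n15 — g0's ASK-NEXT
l.26717: «the one-file U-seeing site knit for `c2BgObjects`∕`c2BgExObjects`»).  `bears_on: R4∕N15 · K3⁷ SpineGivenEndpointR13SepCoPH (stmt-QuantumFields-20544)`.  Filed `--supports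
stmt-QuantumFields-20544 --as helper` — COUNT-NEUTRAL.  Five plumbing `def`s (the scalar-site species read off a bond-coefficient configuration and the (3.65) site perturbation matrices, fine and coarse; the `NE2Objects₁₁` literal), the rest theorems; 0 `sorry`.
Imports this seat's part IX `…N15SiteScalarLayerDressed` (`siteLetters_of_speciesLetters`; parts VII∕VIII, V, IV, II through it) and dag-n15-a V-D `…N15FullPropagatorC2BgExactUnitN15At`
(`ne2PlusUnit_tgCovBgEx`, `tgCovBgEx`, `FGIndexL`; through it dag-n15-c FILE 11 `fgInstanceC2`∕`fgFamilyC2`∕`ne2PlusOperator_fullG_C2`, FILE 10 `fibreOsc_of_fgrad`, n15-b `unstack`∕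
`hasMaj_unstack`∕`hasMaj_idef_unstack`∕`abs_blockAvg_le`) BY NAME; nothing in the tree is modified.

THE SPECIES (MODEL, said plainly).  The family's fine configuration is dag-n15-c's primitive coefficient pair `U = (c′, a′_μ)` on the fine BONDS `Tor (fine (L^mL^k) M) × Fin (d+1)`
((3.35)-regular at level `c₃₅`: `|c′|, |a′_μ|, |∇′c′|, |∇′a′_μ| ≤ c₃₅α₀`, second quotients), the coarse partner its King block averages `Ū = avg₁ U`.  The scalar-site species of index
direction `ν` READS it on the bonds out of each site: `V̂(U)λ̂(x) = c′(x,ν)·λ̂(x, none) + Σ_μ a′_μ(x,μ)·λ̂(x, some μ)` = n15-b's `unstack` — the abelianised first-order shape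
`M_c + Σ_μ M_{a_μ}N∇_μ` of [B9] (3.52) acting on the stacked `(G′λ, N∇_μG′λ)`, with the coefficients of the covariant site Laplacian MODELLED by the bond coefficients at the site's
own bonds (no parallel transport, no colour; the honest upgrade is the lane's curved species, dag-n15-w3∕n15-c).  Its three diagonal letters are theorems of the family's `Reg335`:
sizes `≤ (d+2)c₃₅α₀` (sup letters; block means keep them), fit `≤ 2(d+1)(d+2)c₃₅α₀·L^{−k}` (King-fibre oscillation from the first quotients, FILE 10 `fibreOsc_of_fgrad` +
`fit_blockAvg`) `≤ …·(L^k)^{−γ∕2}`.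

CONTENTS.  §1 defs `c2SiteSpeciesF∕C` (+ `_eq`), defs `c2SitePertF∕C` (the (3.65) site perturbation matrices of the two runs); §2 ★ `c2SiteSpecies_letters` (the three diagonal letters from `Reg335`, every index, constant `Ksp d c₃₅ = 2(d+1)(d+2)c₃₅`); §3 the sub-index
`FGIndexLM d` (`m_T ≥ 1 ∧ m ≥ 1`; non-empty), ★★ `siteLetters_c2Bg` (part II∕IV's `hP` for the dressed site perturbations of the family — part IX ∘ §2); §4 ★★★ **`n15At_fullG_C2_bgExSite`** —
`N15At` with OPERATOR = FILE 11 (U-seeing), UNIT = V-D `tgCovBgEx` (U-seeing, exact dressing), SITE = part II's socket `tgSiteExOn` at the dressed perturbations (U-SEEING): every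
layer of the node's conjunction reads the configuration; §5 the `NE2Objects₁₁` literal `c2BgSiteObjects` + `n15At_…` ∕ `populated_…` (∕ `_family` at `(3, F.hL)`).

HONEST FRAMING.  Count-neutral KNIT; no new estimate.  MODEL-LEVEL in the background species exactly as FILE 11 ∕ V-D are (abelianised first-order coefficients, block-averaged coarse
partner) plus the site-species reading above; the sub-index `m ≥ 1` (part VII's two-grid letters come from King's Prop. 3.8, one or more extra scales); the averaging species
`F₂ = Q′(U′U) − Q′` of (3.65) dropped (part VI's words add it).  GENUINE: the Landau-gauge `G = Δ_a⁻¹`, the massless scalar site propagator `G′`, the site form `Q′G′²Q′*` it perturbs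
(part VII's dictionary), the (2.156) unit-lattice covariance, King's pairing.  NOT [B9] Thms 3.1∕3.2∕3.15 at a general (3.35)-regular `U` (NE2⁺ NOT PRINTED as an η-rate); Node 00's
[B9] layers of record are residual — **N15 is NOT discharged** (typed 28∕28 · discharged 5∕27 of record unchanged); K3⁷'s N15 pin is `fullGSizedObjects` (untouched); one finite
four-torus programme at fixed `ε` — NOT ℝ⁴, NOT infinite volume, NOT OS, NOT a mass gap, NOT Clay; R4 closes the conditional finite-𝕋⁴ rung `BalabanLadder.UV` only.  Restate-immune.
-/

set_option autoImplicit false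

noncomputable section

open scoped BigOperators Matrix
open Finset

namespace Summit.QuantumFields.YangMills.BalabanUVNodes.N15.SiteLayerBg

open Literature.MathematicalPhysics.QuantumFieldTheory.Balaban1983to89
open Literature.MathematicalPhysics.QuantumFieldTheory.Balaban1983to89.B11SectG (BlockNorm HasMaj)
open Literature.MathematicalPhysics.QuantumFieldTheory.Balaban1983to89.T4EtaRate (PairedInstance EtaPairing NE2PlusOperator NE2PlusSite NE2PlusUnit)
open Literature.MathematicalPhysics.QuantumFieldTheory.Balaban1983to89.T4EtaRateDefect (idef)
open Literature.MathematicalPhysics.QuantumFieldTheory.Balaban1983to89.T4EtaRateCoeffDefect (pull diagK diagK_nonneg diagK_mono fibre blockAvg FibreOsc fit_blockAvg)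
open Literature.MathematicalPhysics.QuantumFieldTheory.Balaban1983to89.B5Prop11Plancherel (Tor fine)
open Literature.MathematicalPhysics.QuantumFieldTheory.Balaban1983to89.B4Sect5Torus (tdist)
open Literature.MathematicalPhysics.QuantumFieldTheory.Balaban1983to89.B5QGGQ145Bounds (Idx)
open Literature.MathematicalPhysics.QuantumFieldTheory.Balaban1983to89.NE2NodeTorus (ne2PlusOperator_reindex ne2PlusUnit_reindex)
open Literature.MathematicalPhysics.QuantumFieldTheory.Balaban1983to89.B6UnitTorusCarrier (unitTorusGeo)
open Literature.MathematicalPhysics.QuantumFieldTheory.King1986 (aK)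
open Literature.MathematicalPhysics.QuantumFieldTheory.King1986.Torus (blockOf tdistT)
open Summit.QuantumFields.YangMills.BalabanUVNodes.N15.VectorPiece (unitTorusGeoS kingPr kingPrV bshiftEquiv)
open Summit.QuantumFields.YangMills.BalabanUVNodes.N15.TwoGrid (TGIndex tgGeoC)
open Summit.QuantumFields.YangMills.BalabanUVNodes.N15.BackgroundLayer (unstack unstack_apply blkPair liftPair hasMaj_unstack hasMaj_idef_unstack avg₁ abs_blockAvg_le
  fgInstanceC2 fgFamilyC2 ne2PlusOperator_fullG_C2 fibreOsc_of_fgrad inv_pow_le_rate)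
open Summit.QuantumFields.YangMills.BalabanUVNodes.N15.SiteLayer (dressedOp)
open Summit.QuantumFields.YangMills.BalabanUVNodes.N15.GenuineRecord (FGIndexL)
open Summit.QuantumFields.YangMills.BalabanUVNodes.N15.UnitLayerBg (tgCovBgEx ne2PlusUnit_tgCovBgEx pair_avg_eq)
open Summit.QuantumFields.YangMills.BalabanUVNodes.N15KingModelRung.Curved (kingGOp kingDOp underPtN)
open Literature.MathematicalPhysics.QuantumFieldTheory.Balaban1983to89.T4Continuum (T4Family)
open Summit.QuantumFields.BalabanUV.T4Continuum.HistoryFlow (two_le_L)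
open Summit.QuantumFields.YangMills.BalabanUVNodes.N15.AtKeyedHome (neZero_blockFactor)
open YMDAG.UVSplit (N15At ne2OfRecord₁₁)

variable {d : ℕ} {L : ℕ} [NeZero L]

/-! ## §1 The scalar-site species read off a bond-coefficient configuration -/

section Species

variable (d)

/-- THE SCALAR-SITE SPECIES OF THE FINE RUN at index `(i, ν)`: `V̂(U)λ̂(x) = c′(x,ν)·λ̂(x, none) + Σ_μ a′_μ(x,μ)·λ̂(x, some μ)` — n15-b's `unstack` of the primitive coefficient pair
`U = (c′, a′)` read on the bonds out of `x` (MODEL of the first-order covariant site-Laplacian perturbation, abelianised). [cite: Balaban1985BackgroundPropagators, (3.52) p.400 (first-order perturbation: shape)] -/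
def c2SiteSpeciesF (hL : Odd L ∧ 1 < L) (i : TGIndex × Fin (d + 1)) (U : (fgInstanceC2 d hL i).Bf.Cfg) :
    (Tor (fine (L ^ i.1.m * L ^ i.1.k) (TGIndex.Mn d hL i.1)) × Option (Fin (d + 1)) → ℝ) →ₗ[ℝ] (Tor (fine (L ^ i.1.m * L ^ i.1.k) (TGIndex.Mn d hL i.1)) → ℝ) :=
  unstack (fun x => U.1 (x, i.2)) (fun μ x => U.2 μ (x, μ))

/-- THE SCALAR-SITE SPECIES OF THE COARSE RUN at index `(i, ν)` (same reading of a coarse coefficient pair). [cite: Balaban1985BackgroundPropagators, (3.52) p.400 (shape)] -/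
def c2SiteSpeciesC (hL : Odd L ∧ 1 < L) (i : TGIndex × Fin (d + 1)) (V : (fgInstanceC2 d hL i).Bc.Cfg) :
    (Tor (fine (L ^ i.1.k) (TGIndex.Mn d hL i.1)) × Option (Fin (d + 1)) → ℝ) →ₗ[ℝ] (Tor (fine (L ^ i.1.k) (TGIndex.Mn d hL i.1)) → ℝ) :=
  unstack (fun x => V.1 (x, i.2)) (fun μ x => V.2 μ (x, μ))

variable {d}

/-- Unfolding of the fine species. [folklore] -/
theorem c2SiteSpeciesF_eq (hL : Odd L ∧ 1 < L) (i : TGIndex × Fin (d + 1)) (U : (fgInstanceC2 d hL i).Bf.Cfg) :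
    c2SiteSpeciesF d hL i U = unstack (fun x => U.1 (x, i.2)) (fun μ x => U.2 μ (x, μ)) := rfl

/-- Unfolding of the coarse species. [folklore] -/
theorem c2SiteSpeciesC_eq (hL : Odd L ∧ 1 < L) (i : TGIndex × Fin (d + 1)) (V : (fgInstanceC2 d hL i).Bc.Cfg) :
    c2SiteSpeciesC d hL i V = unstack (fun x => V.1 (x, i.2)) (fun μ x => V.2 μ (x, μ)) := rfl

variable (d)

/-- THE FINE RUN's (3.65) SITE PERTURBATION MATRIX at index `(i, ν)` and configuration `U`: `siteEntries (Q(X(X − G′) + (X − G′)G′)Q*)` with `G′ = kingGOp L a_S 0 (k+m) (L^mL^k) M`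
THE massless scalar site propagator of the fine run and `X = dressedOp G′ D V̂_f(U)` its S4-dressing by §1's species. [cite: Balaban1985BackgroundPropagators, (3.65) p.403 (shape)] -/
def c2SitePertF (hL : Odd L ∧ 1 < L) (aS : ℝ) (i : TGIndex × Fin (d + 1)) (U : (fgInstanceC2 d hL i).Bf.Cfg) :
    Matrix (Idx (TGIndex.Mn d hL i.1)) (Idx (TGIndex.Mn d hL i.1)) ℝ :=
  siteEntries (TGIndex.Mn d hL i.1) (sitePert365 (TGIndex.Mn d hL i.1) (blockOf (L ^ i.1.k) (TGIndex.Mn d hL i.1) ∘ underPtN L i.1.k i.1.m (TGIndex.Mn d hL i.1))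
    (kingGOp L aS 0 (i.1.k + i.1.m) (L ^ i.1.m * L ^ i.1.k) (TGIndex.Mn d hL i.1))
    (dressedOp (kingGOp L aS 0 (i.1.k + i.1.m) (L ^ i.1.m * L ^ i.1.k) (TGIndex.Mn d hL i.1)) (fun μ => kingDOp L aS 0 (i.1.k + i.1.m) (L ^ i.1.m * L ^ i.1.k) (TGIndex.Mn d hL i.1) μ)
      (c2SiteSpeciesF d hL i U)))

/-- THE COARSE RUN's (3.65) SITE PERTURBATION MATRIX at `(i, ν)` and a coarse configuration `V` (`G′ = kingGOp L a_S 0 k (L^k) M`). [cite: Balaban1985BackgroundPropagators, (3.65) p.403 (shape)] -/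
def c2SitePertC (hL : Odd L ∧ 1 < L) (aS : ℝ) (i : TGIndex × Fin (d + 1)) (V : (fgInstanceC2 d hL i).Bc.Cfg) :
    Matrix (Idx (TGIndex.Mn d hL i.1)) (Idx (TGIndex.Mn d hL i.1)) ℝ :=
  siteEntries (TGIndex.Mn d hL i.1) (sitePert365 (TGIndex.Mn d hL i.1) (blockOf (L ^ i.1.k) (TGIndex.Mn d hL i.1)) (kingGOp L aS 0 i.1.k (L ^ i.1.k) (TGIndex.Mn d hL i.1))
    (dressedOp (kingGOp L aS 0 i.1.k (L ^ i.1.k) (TGIndex.Mn d hL i.1)) (fun μ => kingDOp L aS 0 i.1.k (L ^ i.1.k) (TGIndex.Mn d hL i.1) μ) (c2SiteSpeciesC d hL i V)))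

variable {d}

end Species

/-! ## §2 ★ The species' three diagonal letters from the family's `Reg335` -/

section Letters

/-- THE SPECIES CONSTANT `K_sp = 2(d+1)(d+2)·c₃₅` (sizes `(d+2)c₃₅α₀`, fit `2(d+1)(d+2)c₃₅α₀·θ`). [folklore] -/
theorem ksp_nonneg {c35 : ℝ} (hc35 : 0 ≤ c35) : 0 ≤ 2 * ((d : ℝ) + 1) * ((d : ℝ) + 2) * c35 := by positivity

/-- ★ **THE THREE DIAGONAL LETTERS OF THE SCALAR-SITE SPECIES FROM `Reg335`** at every index `(i, ν)` of dag-n15-c's primitive-carrier family and every `0 ≤ γ ≤ 2`: for `α₀ > 0` and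
`U` regular at level `c₃₅ ≥ 0` — `V̂_c(Ū) ≤ diagK (K_sp α₀)` on King's unit blocks (block means keep the sup letters), `V̂_f(U) ≤ diagK (K_sp α₀)` on `blockOf ∘ underPtN`, and the fit
`𝔇(V̂_f(U), V̂_c(Ū)) ≤ diagK (K_sp α₀ (L^k)^{−γ∕2})` through `(pull (liftPair π), pull π)` — the coefficient minus its King block mean is within the fibre oscillation `2(d+1)(L^m − 1)·c₃₅α₀∕(L^mL^k)
≤ 2(d+1)c₃₅α₀·L^{−k}` (FILE 10 `fibreOsc_of_fgrad` from the first-quotient letters, `fit_blockAvg`), and `L^{−k} ≤ (L^k)^{−γ∕2}`.  `K_sp = 2(d+1)(d+2)c₃₅`.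
[cite: Balaban1985BackgroundPropagators, (3.35) p.396 (the letters, shape), (3.52) p.400 (shape); King1986, p.664 (pairing)] -/
theorem c2SiteSpecies_letters (hL : Odd L ∧ 1 < L) {c35 : ℝ} (hc35 : 0 ≤ c35) {γ : ℝ} (hγ2 : γ ≤ 2) (i : TGIndex × Fin (d + 1)) (Msz : ℝ) {α₀ : ℝ} (hα₀ : 0 < α₀)
    (U : (fgInstanceC2 d hL i).Bf.Cfg) (hU : (fgInstanceC2 d hL i).Bf.Reg335 c35 α₀ U) :
    HasMaj (BlockNorm.ofBlocks (unitTorusGeoS L i.1.k (TGIndex.Mn d hL i.1) Msz) (blkPair (blockOf (L ^ i.1.k) (TGIndex.Mn d hL i.1))))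
        (BlockNorm.ofBlocks (unitTorusGeoS L i.1.k (TGIndex.Mn d hL i.1) Msz) (blockOf (L ^ i.1.k) (TGIndex.Mn d hL i.1)))
        (c2SiteSpeciesC d hL i ((fgInstanceC2 d hL i).pair.avg U)) (diagK fun _ => 2 * ((d : ℝ) + 1) * ((d : ℝ) + 2) * c35 * α₀) ∧
      HasMaj (BlockNorm.ofBlocks (unitTorusGeoS L i.1.k (TGIndex.Mn d hL i.1) Msz) (blkPair (blockOf (L ^ i.1.k) (TGIndex.Mn d hL i.1) ∘ underPtN L i.1.k i.1.m (TGIndex.Mn d hL i.1))))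
        (BlockNorm.ofBlocks (unitTorusGeoS L i.1.k (TGIndex.Mn d hL i.1) Msz) (blockOf (L ^ i.1.k) (TGIndex.Mn d hL i.1) ∘ underPtN L i.1.k i.1.m (TGIndex.Mn d hL i.1)))
        (c2SiteSpeciesF d hL i U) (diagK fun _ => 2 * ((d : ℝ) + 1) * ((d : ℝ) + 2) * c35 * α₀) ∧
      HasMaj (BlockNorm.ofBlocks (unitTorusGeoS L i.1.k (TGIndex.Mn d hL i.1) Msz) (blkPair (blockOf (L ^ i.1.k) (TGIndex.Mn d hL i.1))))
        (BlockNorm.ofBlocks (unitTorusGeoS L i.1.k (TGIndex.Mn d hL i.1) Msz) (blockOf (L ^ i.1.k) (TGIndex.Mn d hL i.1) ∘ underPtN L i.1.k i.1.m (TGIndex.Mn d hL i.1)))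
        (idef (pull (liftPair (underPtN L i.1.k i.1.m (TGIndex.Mn d hL i.1)))) (pull (underPtN L i.1.k i.1.m (TGIndex.Mn d hL i.1)))
          (c2SiteSpeciesF d hL i U) (c2SiteSpeciesC d hL i ((fgInstanceC2 d hL i).pair.avg U)))
        (diagK fun _ => 2 * ((d : ℝ) + 1) * ((d : ℝ) + 2) * c35 * α₀ * ((L : ℝ) ^ i.1.k) ^ (-(γ / 2))) := by
  obtain ⟨⟨hA0, hB0⟩, ⟨hC10, hC20⟩, -⟩ := hU
  -- the geometry's size field is `1`: the letters read `c₃₅α₀`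
  have hM1 : c35 * (unitTorusGeo L i.1.k (TGIndex.Mn d hL i.1)).M * α₀ = c35 * α₀ := by
    rw [show (unitTorusGeo L i.1.k (TGIndex.Mn d hL i.1)).M = 1 from rfl, mul_one]
  have hA : ∀ x', |U.1 x'| ≤ c35 * α₀ := fun x' => (hA0 x').trans_eq hM1
  have hB : ∀ μ x', |U.2 μ x'| ≤ c35 * α₀ := fun μ x' => (hB0 μ x').trans_eq hM1
  have hC1 : ∀ κ x', |BackgroundLayer.fgrad ((L ^ i.1.m * L ^ i.1.k : ℕ) : ℝ) (bshiftEquiv (TGIndex.Mn d hL i.1) (L ^ i.1.m * L ^ i.1.k) κ) U.1 x'| ≤ c35 * α₀ :=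
    fun κ x' => (hC10 κ x').trans_eq hM1
  have hC2 : ∀ μ κ x', |BackgroundLayer.fgrad ((L ^ i.1.m * L ^ i.1.k : ℕ) : ℝ) (bshiftEquiv (TGIndex.Mn d hL i.1) (L ^ i.1.m * L ^ i.1.k) κ) (U.2 μ) x'| ≤ c35 * α₀ :=
    fun μ κ x' => (hC20 μ κ x').trans_eq hM1
  set M := TGIndex.Mn d hL i.1 with hMdef
  set k := i.1.k with hkdef
  set m := i.1.m with hmdef
  set ν := i.2 with hνdef
  have hL0 : 0 < L := Nat.pos_of_ne_zero (NeZero.ne L)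
  have hL1 : (1 : ℝ) ≤ (L : ℝ) := by exact_mod_cast hL0
  have hr : 0 ≤ c35 * α₀ := mul_nonneg hc35 hα₀.le
  have hd0 : (0 : ℝ) ≤ d := Nat.cast_nonneg d
  have hcard : (Fintype.card (Fin (d + 1)) : ℝ) = (d : ℝ) + 1 := by rw [Fintype.card_fin]; push_cast; ring
  have hθ : 0 ≤ ((L : ℝ) ^ k) ^ (-(γ / 2)) := Real.rpow_nonneg (pow_nonneg (Nat.cast_nonneg _) _) _
  -- the size constant `(d+2)c₃₅α₀ ≤ K_sp α₀`
  have hsize : c35 * α₀ * (1 + (Fintype.card (Fin (d + 1)) : ℝ)) ≤ 2 * ((d : ℝ) + 1) * ((d : ℝ) + 2) * c35 * α₀ := by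
    rw [hcard]; nlinarith [mul_nonneg hr hd0, hr]
  rw [pair_avg_eq]
  refine ⟨?_, ?_, ?_⟩
  · -- coarse size at the block averages
    have h := hasMaj_unstack (g := unitTorusGeoS L k M Msz) (blockOf (L ^ k) M) (J := Fin (d + 1))
      (c := fun x => (avg₁ (Fin (d + 1)) (kingPrV L k m M) U).1 (x, ν)) (a := fun μ x => (avg₁ (Fin (d + 1)) (kingPrV L k m M) U).2 μ (x, μ)) hr
      (fun x => abs_blockAvg_le _ hr hA _) (fun μ x => abs_blockAvg_le _ hr (hB μ) _)
    exact h.mono fun y y' => diagK_mono (fun _ => hsize) y y'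
  · -- fine size
    have h := hasMaj_unstack (g := unitTorusGeoS L k M Msz) (blockOf (L ^ k) M ∘ underPtN L k m M) (J := Fin (d + 1))
      (c := fun x => U.1 (x, ν)) (a := fun μ x => U.2 μ (x, μ)) hr (fun x => hA _) (fun μ x => hB μ _)
    exact h.mono fun y y' => diagK_mono (fun _ => hsize) y y'
  · -- the fit through King's pairing: coefficient minus its block mean within the fibre oscillation
    have hn' : (0 : ℝ) < ((L ^ m * L ^ k : ℕ) : ℝ) := by positivity
    have hosc1 : FibreOsc (kingPrV L k m M) U.1 (fun _ => ((2 * ((d + 1) * (L ^ m - 1)) : ℕ) : ℝ) * (c35 * α₀ / ((L ^ m * L ^ k : ℕ) : ℝ))) :=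
      fibreOsc_of_fgrad L k m M hn' hC1
    have hosc2 : ∀ μ, FibreOsc (kingPrV L k m M) (U.2 μ) (fun _ => ((2 * ((d + 1) * (L ^ m - 1)) : ℕ) : ℝ) * (c35 * α₀ / ((L ^ m * L ^ k : ℕ) : ℝ))) :=
      fun μ => fibreOsc_of_fgrad L k m M hn' (hC2 μ)
    -- the oscillation bound `≤ 2(d+1)c₃₅α₀·(L^k)^{−γ/2}`
    have hob : ((2 * ((d + 1) * (L ^ m - 1)) : ℕ) : ℝ) * (c35 * α₀ / ((L ^ m * L ^ k : ℕ) : ℝ)) ≤ 2 * ((d : ℝ) + 1) * c35 * α₀ * ((L : ℝ) ^ k) ^ (-(γ / 2)) := by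
      have hLm : (0 : ℝ) < ((L ^ m : ℕ) : ℝ) := by positivity
      have hLk : (0 : ℝ) < ((L ^ k : ℕ) : ℝ) := by positivity
      have h1 : ((2 * ((d + 1) * (L ^ m - 1)) : ℕ) : ℝ) ≤ 2 * ((d : ℝ) + 1) * ((L ^ m : ℕ) : ℝ) := by
        have : ((L ^ m - 1 : ℕ) : ℝ) ≤ ((L ^ m : ℕ) : ℝ) := by exact_mod_cast Nat.sub_le _ _
        push_cast [Nat.cast_sub (Nat.one_le_pow _ _ hL0)] at this ⊢
        nlinarith
      have h2 : (((L ^ k : ℕ) : ℝ))⁻¹ ≤ ((L : ℝ) ^ k) ^ (-(γ / 2)) := inv_pow_le_rate (L := L) hL1 (by linarith)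
      calc ((2 * ((d + 1) * (L ^ m - 1)) : ℕ) : ℝ) * (c35 * α₀ / ((L ^ m * L ^ k : ℕ) : ℝ))
          ≤ 2 * ((d : ℝ) + 1) * ((L ^ m : ℕ) : ℝ) * (c35 * α₀ / ((L ^ m * L ^ k : ℕ) : ℝ)) := mul_le_mul_of_nonneg_right h1 (by positivity)
        _ = 2 * ((d : ℝ) + 1) * c35 * α₀ * (((L ^ k : ℕ) : ℝ))⁻¹ := by
            have : ((L ^ m * L ^ k : ℕ) : ℝ) = ((L ^ m : ℕ) : ℝ) * ((L ^ k : ℕ) : ℝ) := by push_cast; ring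
            rw [this]; field_simp
        _ ≤ 2 * ((d : ℝ) + 1) * c35 * α₀ * ((L : ℝ) ^ k) ^ (-(γ / 2)) := mul_le_mul_of_nonneg_left h2 (by positivity)
    have ho : 0 ≤ 2 * ((d : ℝ) + 1) * c35 * α₀ * ((L : ℝ) ^ k) ^ (-(γ / 2)) := by positivity
    have hfit1 : ∀ x' : Tor (fine (L ^ m * L ^ k) M), |U.1 (x', ν) - (avg₁ (Fin (d + 1)) (kingPrV L k m M) U).1 (underPtN L k m M x', ν)|
        ≤ 2 * ((d : ℝ) + 1) * c35 * α₀ * ((L : ℝ) ^ k) ^ (-(γ / 2)) := fun x' =>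
      (fit_blockAvg (kingPrV L k m M) hosc1 (x', ν)).trans hob
    have hfit2 : ∀ μ (x' : Tor (fine (L ^ m * L ^ k) M)), |U.2 μ (x', μ) - (avg₁ (Fin (d + 1)) (kingPrV L k m M) U).2 μ (underPtN L k m M x', μ)|
        ≤ 2 * ((d : ℝ) + 1) * c35 * α₀ * ((L : ℝ) ^ k) ^ (-(γ / 2)) := fun μ x' =>
      (fit_blockAvg (kingPrV L k m M) (hosc2 μ) (x', μ)).trans hob
    have h := hasMaj_idef_unstack (g := unitTorusGeoS L k M Msz) (blockOf (L ^ k) M) (J := Fin (d + 1)) (underPtN L k m M)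
      (c := fun x => (avg₁ (Fin (d + 1)) (kingPrV L k m M) U).1 (x, ν)) (a := fun μ x => (avg₁ (Fin (d + 1)) (kingPrV L k m M) U).2 μ (x, μ))
      (c' := fun x => U.1 (x, ν)) (a' := fun μ x => U.2 μ (x, μ)) ho hfit1 hfit2
    refine h.mono fun y y' => diagK_mono (fun _ => ?_) y y'
    rw [hcard]; nlinarith [mul_nonneg (mul_nonneg hr hd0) hθ, mul_nonneg hr hθ]

end Letters

/-! ## §3 The sub-index `m ≥ 1` and the site letters of the family -/

section SubIndex

/-- THE SUB-INDEX of dag-n15-a's `FGIndexL` (`m_T ≥ 1`) with AT LEAST ONE EXTRA SCALE `m ≥ 1` (part VII's two-grid letters come from King's Prop. 3.8). [bookkeeping] -/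
abbrev FGIndexLM (d : ℕ) : Type := {i : FGIndexL d // 1 ≤ i.1.1.m}

variable (d) in
/-- NON-VACUITY: `FGIndexLM d` carries `((1, 1, 1), 0)`. [folklore] -/
theorem fgIndexLM_nonempty : Nonempty (FGIndexLM d) := ⟨⟨⟨(⟨1, 1, le_rfl, 1⟩, 0), le_rfl⟩, le_rfl⟩⟩

/-- ★★ **THE THREE SITE LETTERS OF THE FAMILY's DRESSED SITE PERTURBATIONS** (part II∕IV's `hP`), species = §1, `U ≡ 1` layer = the genuine massless scalar site propagator of the run:
part IX `siteLetters_of_speciesLetters` ∘ §2, on the sub-index `m ≥ 1`; odd `L ≥ 3`, `a_S > 0`, `c₃₅ ≥ 0`, `0 < γ < 1`. [cite: Balaban1985BackgroundPropagators, (3.63)–(3.67) pp.402–403 (mechanism), Thm 3.2 (3.48) p.398; King1986, Prop. 3.8 (3.71) p.664] -/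
theorem siteLetters_c2Bg (hLodd : Odd L) (hL2 : 2 ≤ L) (hL : Odd L ∧ 1 < L) {aS : ℝ} (haS : 0 < aS) {c35 : ℝ} (hc35 : 0 ≤ c35) {γ : ℝ} (hγ0 : 0 < γ) (hγ1 : γ < 1) :
    ∃ δP ζ τ a₁ : ℝ, 0 < δP ∧ 0 < ζ ∧ 0 < τ ∧ 0 < a₁ ∧
      ∀ (j : FGIndexLM d) (α₀ : ℝ), 0 < α₀ → α₀ ≤ a₁ → ∀ U : (fgInstanceC2 d hL j.1.1).Bf.Cfg, (fgInstanceC2 d hL j.1.1).Bf.Reg335 c35 α₀ U →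
        (∀ p p' : Idx (TGIndex.Mn d hL j.1.1.1), |c2SitePertC d hL aS j.1.1 ((fgInstanceC2 d hL j.1.1).pair.avg U) p p'| ≤ ζ * α₀ * Real.exp (-(δP * tdist (TGIndex.Mn d hL j.1.1.1) p p'))) ∧
        (∀ p p' : Idx (TGIndex.Mn d hL j.1.1.1), |c2SitePertF d hL aS j.1.1 U p p'| ≤ ζ * α₀ * Real.exp (-(δP * tdist (TGIndex.Mn d hL j.1.1.1) p p'))) ∧
        (∀ p p' : Idx (TGIndex.Mn d hL j.1.1.1), |c2SitePertF d hL aS j.1.1 U p p' - c2SitePertC d hL aS j.1.1 ((fgInstanceC2 d hL j.1.1).pair.avg U) p p'|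
            ≤ τ * ((L : ℝ) ^ j.1.1.1.k) ^ (-(γ / 2)) * Real.exp (-(δP * tdist (TGIndex.Mn d hL j.1.1.1) p p'))) :=
  siteLetters_of_speciesLetters (L := L) (fun j : FGIndexLM d => TGIndex.Mn d hL j.1.1.1) (fun j => j.1.1.1.k) (fun j => j.1.1.1.m) (fun _ => 1)
    (fun j => (fgInstanceC2 d hL j.1.1).Bc) (fun j => (fgInstanceC2 d hL j.1.1).Bf) (fun j => (fgInstanceC2 d hL j.1.1).pair.avg)
    (fun j => c2SiteSpeciesC d hL j.1.1) (fun j => c2SiteSpeciesF d hL j.1.1) hLodd hL2 haS c35 hγ0 hγ1 (mT := fun j => j.1.1.1.mT) (fun _ _ => rfl)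
    (fun j => j.1.1.1.one_le) (fun j => j.2)
    ⟨2 * ((d : ℝ) + 1) * ((d : ℝ) + 2) * c35, 1, ksp_nonneg hc35, one_pos, fun j α₀ hα₀ _ U hU => c2SiteSpecies_letters (d := d) hL hc35 (by linarith) j.1.1 1 hα₀ U hU⟩

end SubIndex

/-! ## §4 ★★★ `N15At` with ALL THREE layers reading the background -/

section Knit

/-- ★★★ **`N15At` — ALL THREE CONJUNCTS BY NAME, EVERY LAYER READING THE BACKGROUND** — on dag-n15-c's primitive-carrier family over the sub-index `m_T, m ≥ 1`: OPERATOR = FILE 11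
`ne2PlusOperator_fullG_C2` (Landau-gauge `G = Δ_b⁻¹` dressed by the primitive coefficient pair), UNIT = dag-n15-a V-D `ne2PlusUnit_tgCovBgEx` (the (2.156) covariance on the EXACTLY dressed
`Δ_k(U) = (Sym QE₀(U)Q*)⁻¹ − b`), SITE = part II's socket `tgSiteExOn` at the (3.65) perturbations `P(U) = siteEntries (sitePert365 blockOf G′ (dressedOp G′ D V̂(U)))` of THE massless scalar
site propagator `G′_k = (−Δ^η + a_kQ′*Q′)⁻¹` by §1's species — `NE2PlusSite` by part II `ne2PlusSite_tgSiteExOn_of_letters` ∘ §3.  `d ≥ 1`, odd `L ≥ 3`, `b, a_S, c₃₅ > 0`, every `α β p`.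
[cite: Balaban1985BackgroundPropagators, Thms 3.1∕3.2∕3.15 (3.42)∕(3.48)∕(3.185) pp.397–398, 432 (quantifier templates), (3.63)–(3.67) pp.402–403 (mechanism); Balaban1984PropagatorsI, (1.45) p.26; King1986, Prop. 3.8 (3.71) p.664] -/
theorem n15At_fullG_C2_bgExSite (hd : 1 ≤ d) (hLodd : Odd L) (hL2 : 2 ≤ L) (hL : Odd L ∧ 1 < L) {b aS : ℝ} (hb : 0 < b) (haS : 0 < aS) {c35 : ℝ} (hc35 : 0 < c35)
    (α β : Fin (d + 1)) (p : ℝ) :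
    N15At { I := FGIndexLM d, c35 := c35, p := p, pi := fun j => fgInstanceC2 d hL j.1.1,
            Kop := fun j => fgFamilyC2 d hL b j.1.1,
            Ksite := tgSiteExOn (fun j : FGIndexLM d => j.1.1.1) (fun j => (fgInstanceC2 d hL j.1.1).gf) (fun j => (fgInstanceC2 d hL j.1.1).Bc)
              (fun j => (fgInstanceC2 d hL j.1.1).Bf) d hL aS (fun j => (fgInstanceC2 d hL j.1.1).pair)
              (fun j U => c2SitePertF d hL aS j.1.1 U) (fun j V => c2SitePertC d hL aS j.1.1 V),
            Kunit := fun j => tgCovBgEx d hL b α β j.1.1,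
            inΛ := fun _ _ => True, unitDist := fun j => (tgGeoC d hL j.1.1.1).dist } := by
  refine ⟨ne2PlusOperator_reindex (fun j : FGIndexLM d => j.1.1) (ne2PlusOperator_fullG_C2 d hd hLodd hL2 hL hb c35 hc35), ?_,
    ne2PlusUnit_reindex (fun j : FGIndexLM d => j.1) (ne2PlusUnit_tgCovBgEx (d := d) hd hLodd hL2 hL hb hc35 α β)⟩
  exact ne2PlusSite_tgSiteExOn_of_letters (d := d) (fun j : FGIndexLM d => j.1.1.1) (fun j => (fgInstanceC2 d hL j.1.1).gf) (fun j => (fgInstanceC2 d hL j.1.1).Bc)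
    (fun j => (fgInstanceC2 d hL j.1.1).Bf) hLodd hL2 hL haS c35 4 p (fun _ => le_rfl) (fun j => (fgInstanceC2 d hL j.1.1).pair)
    (fun j U => c2SitePertF d hL aS j.1.1 U) (fun j V => c2SitePertC d hL aS j.1.1 V) (half_pos one_half_pos)
    (siteLetters_c2Bg (d := d) hLodd hL2 hL haS hc35.le one_half_pos (by norm_num))

end Knit

/-! ## §5 The `NE2Objects₁₁` literal of the all-layers-U-seeing family and its keyed faces (V-D's pattern) -/

section Record

variable (d)

/-- **N15's NE2 OBJECTS OF THE PRIMITIVE-CARRIER FAMILY WITH ALL THREE LAYERS READING THE BACKGROUND** (RR-1's layer-A container): V-D's `c2BgExObjects` on the sub-index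
`m ≥ 1` with the site kernel the DRESSED site socket `tgSiteExOn` at §1's perturbations. [bookkeeping] -/
def c2BgSiteObjects (hL : Odd L ∧ 1 < L) (b aS : ℝ) (α β : Fin (d + 1)) (c35 p : ℝ) : Node00.NE2Objects₁₁ where
  I := FGIndexLM d
  c35 := c35
  p := p
  pi := fun j => fgInstanceC2 d hL j.1.1
  Kop := fun j => fgFamilyC2 d hL b j.1.1
  Ksite := tgSiteExOn (fun j : FGIndexLM d => j.1.1.1) (fun j => (fgInstanceC2 d hL j.1.1).gf) (fun j => (fgInstanceC2 d hL j.1.1).Bc)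
    (fun j => (fgInstanceC2 d hL j.1.1).Bf) d hL aS (fun j => (fgInstanceC2 d hL j.1.1).pair)
    (fun j U => c2SitePertF d hL aS j.1.1 U) (fun j V => c2SitePertC d hL aS j.1.1 V)
  Kunit := fun j => tgCovBgEx d hL b α β j.1.1
  inΛ := fun _ _ => True
  unitDist := fun j => (tgGeoC d hL j.1.1.1).dist

variable {d}

/-- ★★★ **`N15At` AT THE OBJECTS' BUNDLE** (`d ≥ 1`, odd `L ≥ 3`, `b, a_S, c₃₅ > 0`). [bookkeeping] -/
theorem n15At_c2BgSiteObjects (hd : 1 ≤ d) (hLodd : Odd L) (hL2 : 2 ≤ L) (hL : Odd L ∧ 1 < L) {b aS : ℝ} (hb : 0 < b) (haS : 0 < aS) {c35 : ℝ} (hc35 : 0 < c35)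
    (α β : Fin (d + 1)) (p : ℝ) : N15At (ne2OfRecord₁₁ (c2BgSiteObjects d hL b aS α β c35 p)) :=
  n15At_fullG_C2_bgExSite (d := d) hd hLodd hL2 hL hb haS hc35 α β p

/-- **RR-1's DISPLAY HOLDS AT THE LITERAL**: `Populated`. [bookkeeping] -/
theorem populated_c2BgSiteObjects (hL : Odd L ∧ 1 < L) (b aS : ℝ) (α β : Fin (d + 1)) (c35 p : ℝ) :
    (c2BgSiteObjects d hL b aS α β c35 p).Populated :=
  (Node00.NE2Objects₁₁.populated_iff _).2 (fgIndexLM_nonempty d)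

/-- `N15At` at the family-keyed literal (`(3, F.hL)`; `b, a_S, c₃₅ > 0`) — every layer reading the background. [bookkeeping] -/
theorem n15At_c2BgSiteObjects_family {b aS : ℝ} (hb : 0 < b) (haS : 0 < aS) {c35 : ℝ} (hc35 : 0 < c35) (α β : Fin 4) (p : ℝ) (F : T4Family) :
    N15At (ne2OfRecord₁₁ (haveI := neZero_blockFactor F; c2BgSiteObjects 3 F.hL b aS α β c35 p)) := by
  haveI := neZero_blockFactor F
  exact n15At_c2BgSiteObjects (d := 3) (by norm_num) F.hL.1 (two_le_L F) F.hL hb haS hc35 α β p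

/-- **RR-1's DISPLAY AT THE FAMILY-KEYED LITERAL**. [bookkeeping] -/
theorem populated_c2BgSiteObjects_family (F : T4Family) (b aS : ℝ) (α β : Fin 4) (c35 p : ℝ) :
    (haveI := neZero_blockFactor F; c2BgSiteObjects 3 F.hL b aS α β c35 p).Populated := by
  haveI := neZero_blockFactor F
  exact populated_c2BgSiteObjects F.hL b aS α β c35 p

end Record

end Summit.QuantumFields.YangMills.BalabanUVNodes.N15.SiteLayerBg

end
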